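import Summits.Parity.GeneralizedHardyLittlewood.Theorems.RomanoffHeathBrownSecondMomentTools
import Summits.Parity.GeneralizedHardyLittlewood.Theorems.RomanoffHeathBrownAssemblyTools

/-! # RomanoffHeathBrown — the assembly: `assembly_proof : Assembly` (item stmt-Parity-20276 of
`route-Parity-RomanoffHeathBrown`)

Romanoff's Cauchy–Schwarz, ε-free. Take `c, c₁` from `HBMassLower`, `C_S` from
`SmallModuliCorrelation c`, `LargeModuliCorrelation c` at `ε = 1`, `C_R` from `SecondMomentReduction c`.
For `N` beyond all thresholds, with `R(n) = ∑_{k ≤ N} u(k) θ_N(n − k)`, `U = ∑ u`: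
`∑_{n ≤ 2N} R(n)² ≤ C_R (N log N)(N^{1/3} log N (ηX+2)) U + C_R N (C_S + 1) η²N U ≤ C' η² N² U`
(the diagonal is `o(η²N²)`, `eventually_diag_le`), `∑_{n ≤ 2N} R(n) ≥ (N/2) U` (Chebyshev,
`first_moment_ge`), and `R(n) ≠ 0` forces `n` even and represented (`rep_of_sum_ne_zero`); hence
`#{n ≤ 2N represented} ≥ (NU/2)²/(C' η² N² U) ≥ c₁ N/(4C')`, and `N ↦ ⌊N/2⌋` gives the target's
`n ≤ N` with `c₀ = c₁/(16 C')`.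
Sources: [Nathanson1996] (§7.6), [Romanoff1934], [HeathBrownActa2001]. -/

noncomputable section

open Finset Filter
open scoped Topology

namespace Summit.Parity.GeneralizedHardyLittlewood.Theses.RomanoffHeathBrown

open Literature.NumberTheory.Sieve Literature.NumberTheory.Sieve.CubicPrimes
open Literature.NumberTheory.Sieve.CubicMinorant

/-- The moduli `d ≤ N`, odd and square-free, split at a real threshold `s` into `d ≤ s` and `s < d`
(how `SmallModuliCorrelation` and `LargeModuliCorrelation` tile the divisor sum of
`SecondMomentReduction`). [folklore] -/
theorem sum_oddSquarefree_split (K : Finset ℕ) (F : ℕ → ℝ) (s : ℝ) :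
    ∑ d ∈ K.filter (fun d : ℕ => Squarefree d ∧ Odd d), F d =
      ∑ d ∈ K.filter (fun d : ℕ => Squarefree d ∧ Odd d ∧ (d : ℝ) ≤ s), F d +
        ∑ d ∈ K.filter (fun d : ℕ => Squarefree d ∧ Odd d ∧ s < (d : ℝ)), F d := by
  rw [← Finset.sum_filter_add_sum_filter_not (K.filter (fun d : ℕ => Squarefree d ∧ Odd d))
    (fun d : ℕ => (d : ℝ) ≤ s) F, Finset.filter_filter, Finset.filter_filter]
  congr 1
  · exact Finset.sum_congr (Finset.filter_congr fun d _ => and_assoc) fun _ _ => rfl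
  · exact Finset.sum_congr (Finset.filter_congr fun d _ => by rw [and_assoc, not_le]) fun _ _ => rfl

/-- **Assembly PROVED** (item stmt-Parity-20276): the four blocks give a positive proportion of even
`n ≤ N` of the form `p + (x³ + 2y³)` with `p`, `x³ + 2y³` prime. [this line] -/
theorem assembly_proof : Assembly := by
  unfold Assembly
  intro hSmall hLarge hMass hSecond
  unfold GoldbachHeathBrownPositiveDensity
  unfold SmallModuliCorrelation at hSmall
  unfold LargeModuliCorrelation at hLarge
  unfold HBMassLower at hMass
  unfold SecondMomentReduction at hSecond
  obtain ⟨c, hc, c₁, hc₁, N₁, hM⟩ := hMass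
  obtain ⟨CS, N₂, hS⟩ := hSmall c hc
  obtain ⟨N₃, hLg⟩ := hLarge c hc 1 one_pos
  obtain ⟨CR, N₄, hR⟩ := hSecond c hc
  obtain ⟨N₅, hN₅⟩ := Filter.eventually_atTop.mp
    (eventually_theta_ge_half.and ((eventually_diag_le hc).and (eventually_gt_atTop 6)))
  set C' : ℝ := max CR 0 * (max CS 0 + 2) + 1 with hC'
  have hCR0 : 0 ≤ max CR 0 := le_max_right _ _
  have hCS0 : 0 ≤ max CS 0 := le_max_right _ _
  have hC'0 : 0 < C' := by positivity
  refine ⟨c₁ / (16 * C'), by positivity, 2 * (N₁ + N₂ + N₃ + N₄ + N₅ + 1), fun N' hN' => ?_⟩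
  -- work at `N = ⌊N'/2⌋`
  obtain ⟨N, hNlo, hNN', hN'N⟩ :
      ∃ N : ℕ, N₁ + N₂ + N₃ + N₄ + N₅ + 1 ≤ N ∧ 2 * N ≤ N' ∧ N' ≤ 2 * N + 1 :=
    ⟨N' / 2, by omega, by omega, by omega⟩
  obtain ⟨hθ, hdiag, hN6⟩ := hN₅ N (by omega)
  have hMN := hM N (by omega)
  have hSN := hS N (by omega)
  have hLN := hLg N (by omega)
  have hRN := hR N (by omega)
  clear hM hS hLg hR hN₅
  -- abbreviations
  set K := Icc 1 N with hK
  set u : ℕ → ℝ := hbWeight c N with hu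
  set η := hbEta c N with hη
  set X := hbX N with hX
  set U := ∑ k ∈ K, u k with hU
  set F : ℕ → ℝ := fun d => (∏ p ∈ d.primeFactors, (1 : ℝ) / ((p : ℝ) - 2)) *
    ∑ r ∈ Finset.range d, (∑ k ∈ K.filter (fun k : ℕ => k ≡ r [MOD d]), u k) ^ 2 with hF
  set E := ∑ d ∈ K.filter (fun d : ℕ => Squarefree d ∧ Odd d), F d with hE
  set R : ℕ → ℝ := fun n => ∑ k ∈ K, u k *
    (if (n - k).Prime ∧ Odd (n - k) ∧ n - k ≤ N then Real.log ((n - k : ℕ) : ℝ) else 0) with hRdef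
  set M : ℝ := (N : ℝ) ^ ((1 : ℝ) / 3) * Real.log N * (η * X + 2) with hMdef
  -- basic signs
  have hN0 : (0 : ℝ) < N := by exact_mod_cast (show 0 < N by omega)
  have hlogN : 0 ≤ Real.log N := Real.log_natCast_nonneg N
  have hu0 : ∀ k, 0 ≤ u k := fun k => hbWeight_nonneg c N k
  have hU0 : 0 ≤ U := Finset.sum_nonneg fun k _ => hu0 k
  have hη0 : 0 < η := by
    rw [hη]; unfold hbEta; exact Real.rpow_pos_of_pos (hbX_facts hN6).2.1 _
  have hM0 : 0 ≤ M := by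
    have : 0 ≤ X := hbX_nonneg N
    positivity
  -- the hypotheses in the abbreviated form
  have hRN' : ∑ n ∈ Icc 1 (2 * N), R n ^ 2 ≤ CR * ((N : ℝ) * Real.log N) * M * U + CR * N * E := hRN
  have hSN' : ∑ d ∈ K.filter (fun d : ℕ => Squarefree d ∧ Odd d ∧ (d : ℝ) ≤ Real.sqrt (η * X)), F d ≤
      CS * (η ^ 2 * N) * U := hSN
  have hLN' : ∑ d ∈ K.filter (fun d : ℕ => Squarefree d ∧ Odd d ∧ Real.sqrt (η * X) < (d : ℝ)), F d ≤
      1 * (η ^ 2 * N) * U := hLN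
  have hMN' : c₁ * (η ^ 2 * N) ≤ U := hMN
  have hdiag' : ((N : ℝ) * Real.log N) * M ≤ η ^ 2 * N * N := hdiag
  clear hRN hSN hLN hMN hdiag
  -- the class energies: Small + Large
  have hEle : E ≤ (max CS 0 + 1) * (η ^ 2 * N * U) := by
    have hpos : 0 ≤ η ^ 2 * N * U := by positivity
    rw [hE, sum_oddSquarefree_split K F (Real.sqrt (η * X))]
    calc _ ≤ CS * (η ^ 2 * N) * U + 1 * (η ^ 2 * N) * U := add_le_add hSN' hLN'
      _ = CS * (η ^ 2 * N * U) + η ^ 2 * N * U := by ring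
      _ ≤ max CS 0 * (η ^ 2 * N * U) + η ^ 2 * N * U :=
          add_le_add (mul_le_mul_of_nonneg_right (le_max_left _ _) hpos) le_rfl
      _ = (max CS 0 + 1) * (η ^ 2 * N * U) := by ring
  -- the second moment
  have hB : ∑ n ∈ Icc 1 (2 * N), R n ^ 2 ≤ C' * (η ^ 2 * N * N * U) := by
    have ha : 0 ≤ ((N : ℝ) * Real.log N) * M * U := by positivity
    have hE0 : 0 ≤ E := by
      rw [hE]
      refine Finset.sum_nonneg fun d hd => mul_nonneg ?_ (Finset.sum_nonneg fun _ _ => sq_nonneg _)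
      exact prod_primeFactors_inv_sub_two_nonneg (mem_filter.mp hd).2.2
    have hb : 0 ≤ (N : ℝ) * E := by positivity
    have h1 : CR * ((N : ℝ) * Real.log N) * M * U ≤ max CR 0 * (η ^ 2 * N * N * U) := by
      calc CR * ((N : ℝ) * Real.log N) * M * U = CR * (((N : ℝ) * Real.log N) * M * U) := by ring
        _ ≤ max CR 0 * (((N : ℝ) * Real.log N) * M * U) :=
            mul_le_mul_of_nonneg_right (le_max_left _ _) ha
        _ ≤ max CR 0 * (η ^ 2 * N * N * U) :=
            mul_le_mul_of_nonneg_left (mul_le_mul_of_nonneg_right hdiag' hU0) hCR0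
    have h2 : CR * (N : ℝ) * E ≤ max CR 0 * ((N : ℝ) * ((max CS 0 + 1) * (η ^ 2 * N * U))) := by
      calc CR * (N : ℝ) * E = CR * ((N : ℝ) * E) := by ring
        _ ≤ max CR 0 * ((N : ℝ) * E) := mul_le_mul_of_nonneg_right (le_max_left _ _) hb
        _ ≤ max CR 0 * ((N : ℝ) * ((max CS 0 + 1) * (η ^ 2 * N * U))) :=
            mul_le_mul_of_nonneg_left (mul_le_mul_of_nonneg_left hEle hN0.le) hCR0
    have hpos : 0 ≤ η ^ 2 * N * N * U := by positivity
    calc ∑ n ∈ Icc 1 (2 * N), R n ^ 2 ≤ _ := hRN'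
      _ ≤ max CR 0 * (η ^ 2 * N * N * U) +
            max CR 0 * ((N : ℝ) * ((max CS 0 + 1) * (η ^ 2 * N * U))) := add_le_add h1 h2
      _ = (max CR 0 * (max CS 0 + 2)) * (η ^ 2 * N * N * U) := by ring
      _ ≤ C' * (η ^ 2 * N * N * U) := mul_le_mul_of_nonneg_right (by rw [hC']; linarith) hpos
  -- the first moment
  have hA : (N : ℝ) / 2 * U ≤ ∑ n ∈ Icc 1 (2 * N), R n := first_moment_ge hθ hu0
  have hA0 : 0 ≤ (N : ℝ) / 2 * U := by positivity
  -- Cauchy–Schwarz on the support `S`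
  set S := (Icc 1 (2 * N)).filter (fun n => R n ≠ 0) with hSdef
  have hCS : (∑ n ∈ Icc 1 (2 * N), R n) ^ 2 ≤ #S * ∑ n ∈ Icc 1 (2 * N), R n ^ 2 :=
    sq_sum_le_card_support_mul_sum_sq _ R
  have hchain : ((N : ℝ) / 2 * U) ^ 2 ≤ #S * (C' * (η ^ 2 * N * N * U)) := by
    calc ((N : ℝ) / 2 * U) ^ 2 ≤ (∑ n ∈ Icc 1 (2 * N), R n) ^ 2 := pow_le_pow_left₀ hA0 hA 2
      _ ≤ #S * ∑ n ∈ Icc 1 (2 * N), R n ^ 2 := hCS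
      _ ≤ #S * (C' * (η ^ 2 * N * N * U)) := mul_le_mul_of_nonneg_left hB (Nat.cast_nonneg _)
  have hUpos : 0 < U := lt_of_lt_of_le (by positivity) hMN'
  have hS1 : U / 4 ≤ #S * C' * η ^ 2 := by
    have hpos : 0 < (N : ℝ) ^ 2 * U := by positivity
    have e1 : ((N : ℝ) / 2 * U) ^ 2 = (U / 4) * ((N : ℝ) ^ 2 * U) := by ring
    have e2 : (#S : ℝ) * (C' * (η ^ 2 * N * N * U)) = (#S * C' * η ^ 2) * ((N : ℝ) ^ 2 * U) := by
      ring
    rw [e1, e2] at hchain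
    exact le_of_mul_le_mul_right hchain hpos
  have hS2 : c₁ / (4 * C') * N ≤ #S := by
    have hη2 : 0 < η ^ 2 := by positivity
    have h1 : (c₁ * N / 4) * η ^ 2 ≤ (#S * C') * η ^ 2 := by
      have : c₁ * (η ^ 2 * N) / 4 ≤ #S * C' * η ^ 2 := by linarith
      linarith
    have h2 : c₁ * N / 4 ≤ #S * C' := le_of_mul_le_mul_right h1 hη2
    rw [div_mul_eq_mul_div, div_le_iff₀ (by positivity)]
    linarith
  -- the support is contained in the target set
  have key : ∀ T : Finset ℕ, S ⊆ T → c₁ / (16 * C') * (N' : ℝ) ≤ (#T : ℝ) := by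
    intro T hT
    have hcard : (#S : ℝ) ≤ #T := by exact_mod_cast Finset.card_le_card hT
    refine le_trans ?_ (hS2.trans hcard)
    have h1 : (N' : ℝ) ≤ 2 * N + 1 := by exact_mod_cast hN'N
    have h2 : (1 : ℝ) ≤ N := by exact_mod_cast (show 1 ≤ N by omega)
    have h3 : (N' : ℝ) ≤ 4 * N := by linarith
    calc c₁ / (16 * C') * (N' : ℝ) ≤ c₁ / (16 * C') * (4 * N) :=
          mul_le_mul_of_nonneg_left h3 (by positivity)
      _ = c₁ / (4 * C') * N := by field_simp; ring
  refine key _ fun n hn => ?_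
  rw [hSdef, mem_filter] at hn
  obtain ⟨hn1, hRn⟩ := hn
  simp only [Finset.mem_filter]
  refine ⟨?_, rep_of_sum_ne_zero hRn⟩
  rw [mem_Icc] at hn1 ⊢
  omega

end Summit.Parity.GeneralizedHardyLittlewood.Theses.RomanoffHeathBrown

end
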